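import Mathlib
import HarnessLib
import Literature.Analysis.FluidPDE.MildAncientTimeDecayRegularity
import Summits.NavierStokesRegularity.NavierStokesRegularity.Theorems.PoloidalWindowDoorLrcModEntireRidgeClass
import Summits.NavierStokesRegularity.NavierStokesRegularity.Theorems.PoloidalWindowDoorLrcModEntireRidgeGlobalBranchProper
import Summits.NavierStokesRegularity.NavierStokesRegularity.Theorems.PoloidalWindowDoorLrcModEntireTwistingTHRidgeLawNested

/-!
# Route `PoloidalWindowDoor`, item `LrcModEntire` (stmt-NavierStokesRegularity-20428), cells (Q4-curved)/(Q4-sonic) of the (TH) column —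
# THE LIMIT BRANCH OF THE (Q4) PACKAGE IS AN INJECTIVE, PROPERLY EMBEDDED LINE, and the hull limit obeys the RIDGE LAW on its whole hot set

Cell ns-regularity-ideate, stub-worker seat ns-poloidal-K2-p2 g16 under the LEAD of item 20428 (ns-poloidal-K2-p3 g16);
`--supports stmt-NavierStokesRegularity-20428 --as helper`.  Memo `Cruxes/LrcModEntire/T2B-g16.md` §3/§5 (the «bounded», «closed web» and «circle» horns).

Input = conjuncts of the U-package of the registered stubs `stub_Q4curved` / `stub_Q4sonic` (skeleton `Cruxes/LrcModEntire/Lines/twist_split.lean` v10), in the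
hypothesis names of LEAD g16's `…Q4WebPackage.line_web_package`: the hull limit `U` (class, poloidal, pinned, Type-I normalised, PEAKLESS `hUpeak`, re-entry
`hUcrit`: `∇U₂(−1,·) = 0` on its hot set), the (TH) slope structure (`hμ3`, `hevU`), and the limit branch `Γ` (`C²`, horizontal, unit speed, hot, with
`κ ≤ −D²(σU₂(−1,·))(Γ s)[ν,ν]`, `κ > 0`).  Output:

* `hiso_of_peakless` — Peakless + the Type-I normalisation ⇒ «no compact isolated hot piece» for `f = σU₂(−1,·)` on `P₀` (the hot value IS the maximum);
* `ridgeLaw_of_limit` — ★ THE RIDGE LAW FOR THE HULL LIMIT ON ITS WHOLE HOT SET: `D²f(y)[e₀,e₀] + D²f(y)[e₁,e₁] = −κ'` at EVERY hot point `y ∈ P₀` of `U`, with ONE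
  `κ' ≥ κ > 0` (LEAD g13's `…TwistingTHRidgeLaw.horizLaplacian_two_eq_of_hotPoints` for `U` — the slope `μ(−1,0) ≤ 0 ≠ 1` by `…TwistingTHSlopeSign.slopeFunction_nonpos` —
  and the frame trace at `Γ 0`, where `Γ′(0)` is a kernel direction);
* ★ `limitBranch_injective_proper` — `Γ` is INJECTIVE and PROPER: `‖Γ s‖ → ∞` as `s → ±∞` (LEAD g15's class-free `…RidgeGlobalBranchProper.goodCurve_injective` /
  `tendsto_norm_goodCurve_atTop/atBot` for `f`, fed with the KNSS slice bounds, `hUcrit`, the ridge law above, and `hiso_of_peakless`).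

USE (memo §3/§5 and this seat's `…PlanarCurveRigidity`): properness excludes the bounded horns — PERIODIC curvature of `Γ` ⇒ a non-zero horizontal translation
period (`exists_translation_period_of_tendsto`), CONSTANT curvature ⇒ `Γ` is the line `s ↦ s•Γ′(0)` (`isLine_of_constant_curvature_of_tendsto`).
WHAT THIS IS NOT: not a claim about Navier–Stokes regularity — topology of the hypothetical limit branch of research cell (Q4); items 20428 / 19708 / 27893 OPEN.
-/

noncomputable section

-- the summit and its single sub-problem share the name (CONVENTIONS §1), as in every Theorems file
set_option linter.dupNamespace false

namespace Summit.NavierStokesRegularity.NavierStokesRegularity.Theorems.PoloidalWindowDoorLrcModEntireQ4LimitBranchProper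

open Set Filter Topology Metric Function
open scoped InnerProductSpace RealInnerProductSpace ContDiff
open Literature.Analysis Literature.Analysis.FluidPDE Literature.Analysis.UnboundedOperators
open Summit.NavierStokesRegularity.NavierStokesRegularity.Theorems.LocalSineTubeDoorProfileAlignedWindowRigidityAncient
open Summit.NavierStokesRegularity.NavierStokesRegularity.Theorems.PoloidalWindowDoorLrcModEntireRidgeClass
open Summit.NavierStokesRegularity.NavierStokesRegularity.Theorems.PoloidalWindowDoorLrcModEntireRidgeGlobalBranchODE
open Summit.NavierStokesRegularity.NavierStokesRegularity.Theorems.PoloidalWindowDoorLrcModEntireRidgeGlobalBranchFrame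
open Summit.NavierStokesRegularity.NavierStokesRegularity.Theorems.PoloidalWindowDoorLrcModEntireRidgeGlobalBranchUnique
open Summit.NavierStokesRegularity.NavierStokesRegularity.Theorems.PoloidalWindowDoorLrcModEntireRidgeGlobalBranchProper
open Summit.NavierStokesRegularity.NavierStokesRegularity.Theorems.PoloidalWindowDoorLrcModEntireTwistingTHRidgeLaw
open Summit.NavierStokesRegularity.NavierStokesRegularity.Theorems.PoloidalWindowDoorLrcModEntireTwistingTHSlopeSign
open Summit.NavierStokesRegularity.NavierStokesRegularity.Theorems.PoloidalWindowDoorLrcModEntireRidgeWiring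

variable {C : ℝ} {U : ℝ → EuclideanSpace ℝ (Fin 3) → EuclideanSpace ℝ (Fin 3)}

/-- **Peakless + normalisation ⇒ no compact isolated hot piece** for `f = σ·U₂(−1,·)` on the thread plane: the hot value `σ·U₂(−1,0) = |U₂(−1,0)|` is the
maximum of `f` on `P₀` (Type-I normalisation at `t = −1`), so a compact hot `K` isolated by an open `O` is a compact isolated planar argmax island — which the
Peakless clause (at `s = −1`, height `0`, sign `σ`, level `M`) forbids. -/
theorem hiso_of_peakless (hUhotbd : ∀ t < 0, ∀ x, Real.sqrt (-t) * |U t x 2| ≤ |U (-1) 0 2|)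
    {σ : ℝ} (hσ : σ = 1 ∨ σ = -1) (hσN : σ * U (-1) 0 2 = |U (-1) 0 2|)
    (hUpeak : ∀ (s z₀ σ M : ℝ) (K O : Set (EuclideanSpace ℝ (Fin 3))), s < 0 →
      ((σ = 1 ∨ σ = -1) ∧ IsCompact K ∧ K.Nonempty ∧ (∀ q ∈ K, q 2 = z₀ ∧ σ * U s q 2 = M) ∧
        IsOpen O ∧ K ⊆ O ∧ (∀ q ∈ O, q 2 = z₀ → σ * U s q 2 ≤ M) ∧
        (∀ q ∈ O, q 2 = z₀ → σ * U s q 2 = M → q ∈ K)) → False) :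
    ∀ K : Set (EuclideanSpace ℝ (Fin 3)), IsCompact K → K.Nonempty → (∀ y ∈ K, y 2 = 0 ∧ (fun y => σ * U (-1) y 2) y = σ * U (-1) 0 2) →
      ∀ O : Set (EuclideanSpace ℝ (Fin 3)), IsOpen O → K ⊆ O →
        (∀ y ∈ O, y 2 = 0 → (fun y => σ * U (-1) y 2) y = σ * U (-1) 0 2 → y ∈ K) → False := by
  intro K hK hKne hKhot O hO hKO hOK
  refine hUpeak (-1) 0 σ (σ * U (-1) 0 2) K O (by norm_num) ⟨hσ, hK, hKne, fun q hq => hKhot q hq, hO, hKO, fun q _ _ => ?_, fun q hq hq2 hqM => hOK q hq hq2 hqM⟩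
  -- `σ U₂(−1,q) ≤ |U₂(−1,q)| ≤ |N| = σ N`
  have h1 := hUhotbd (-1) (by norm_num) q
  rw [neg_neg, Real.sqrt_one, one_mul] at h1
  have hσ1 : |σ| = 1 := by rcases hσ with h | h <;> simp [h]
  have h2 : σ * U (-1) q 2 ≤ |U (-1) q 2| := by
    have := le_abs_self (σ * U (-1) q 2); rwa [abs_mul, hσ1, one_mul] at this
  rw [hσN]; exact h2.trans h1

/-- ★ **THE RIDGE LAW FOR THE HULL LIMIT ON ITS WHOLE HOT SET.**  For the U-package of (Q4) (class, poloidal, pinned, normalised, re-entry `∇U₂(−1,·) = 0` on the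
hot set, `C³` slope function `μ` with the slope form eventually near every point of `{−1} × P₀`) and a `C²` unit-speed hot curve `Γ` in `P₀` with
`κ ≤ −D²(σU₂(−1,·))(Γ s)[ν s, ν s]`: there is ONE `κ' ≥ κ` with `D²f(y)[e₀,e₀] + D²f(y)[e₁,e₁] = −κ'` at every hot `y ∈ P₀`, `f = σU₂(−1,·)`. -/
theorem ridgeLaw_of_limit (hUrate : HasTypeITimeDecay C U) (hUcont : ContinuousOn (uncurry U) (Iio (0 : ℝ) ×ˢ univ))
    (hUmild : ∀ s t : ℝ, s < t → t < 0 → ∀ x, U t x = heatExtension (U s) (t - s) x - oseenDuhamel 1 s U U t x)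
    (hUdiv : ∀ t < 0, VectorCalculus.IsDivFree (U t))
    (hUpol : ∀ s < 0, ∀ q, ⟪curl (U s) q, EuclideanSpace.single 2 1⟫_ℝ = 0)
    (hUne : U (-1) 0 2 ≠ 0) (hUhotbd : ∀ t < 0, ∀ x, Real.sqrt (-t) * |U t x 2| ≤ |U (-1) 0 2|)
    (hUcrit : ∀ y ∈ {y : EuclideanSpace ℝ (Fin 3) | y 2 = 0 ∧ U (-1) y 2 = U (-1) 0 2}, fderiv ℝ (fun x => U (-1) x 2) y = 0)
    {σ κ : ℝ} (hσ : σ = 1 ∨ σ = -1)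
    {Γ νΓ : ℝ → EuclideanSpace ℝ (Fin 3)} (hΓc2 : ContDiff ℝ 2 Γ) (hΓ2 : ∀ s, Γ s 2 = 0) (hΓunit : ∀ s, ‖deriv Γ s‖ = 1)
    (hΓhot : ∀ s, U (-1) (Γ s) 2 = U (-1) 0 2)
    (hν : ∀ s, νΓ s = WithLp.toLp 2 ![-(deriv Γ s 1), deriv Γ s 0, 0])
    (hΓcurv : ∀ s, κ ≤ -(fderiv ℝ (fderiv ℝ (fun y => σ * U (-1) y 2)) (Γ s) (νΓ s) (νΓ s)))
    {μ : ℝ → ℝ → ℝ} {ρ : ℝ} (hρ : 0 < ρ) (hμ3 : ContDiff ℝ 3 (uncurry μ))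
    (hevU : ∀ t₀ : ℝ, |t₀ + 1| < ρ → ∀ y₀ : EuclideanSpace ℝ (Fin 3), y₀ 2 = 0 →
      ∀ᶠ z in 𝓝 ((t₀, y₀) : ℝ × EuclideanSpace ℝ (Fin 3)), ∀ b : Fin 3, b ≠ 2 →
        fderiv ℝ (U z.1) z.2 (EuclideanSpace.single 2 1) b = μ z.1 (z.2 2) * fderiv ℝ (U z.1) z.2 (EuclideanSpace.single b 1) 2) :
    ∃ κ' : ℝ, κ ≤ κ' ∧ ∀ y : EuclideanSpace ℝ (Fin 3), y 2 = 0 → (fun y => σ * U (-1) y 2) y = σ * U (-1) 0 2 →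
      fderiv ℝ (fderiv ℝ (fun y => σ * U (-1) y 2)) y e0 e0 + fderiv ℝ (fderiv ℝ (fun y => σ * U (-1) y 2)) y e1 e1 = -κ' := by
  have h1 : (-1 : ℝ) < 0 := by norm_num
  have hσ0 : σ ≠ 0 := by rcases hσ with rfl | rfl <;> norm_num
  set f : EuclideanSpace ℝ (Fin 3) → ℝ := fun y => σ * U (-1) y 2 with hfdef
  set θ : EuclideanSpace ℝ (Fin 3) → ℝ := fun y => U (-1) y 2 with hθdef
  set M : ℝ := σ * U (-1) 0 2 with hMdef
  -- slice regularity
  have hslice_an : AnalyticOnNhd ℝ (U (-1)) univ := analyticOnNhd_slice hUcont (bdd_of_hasTypeITimeDecay hUrate) hUmild h1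
  have hθan : AnalyticOnNhd ℝ θ univ := fun y hy => ((EuclideanSpace.proj (𝕜 := ℝ) (2 : Fin 3)).analyticAt _).comp (hslice_an y hy)
  have hθ : ContDiff ℝ 2 θ := hθan.contDiff.of_le le_top
  have hfθ : f = σ • θ := by funext y; simp [hfdef, hθdef, smul_eq_mul]
  have hf : ContDiff ℝ 2 f := by rw [hfθ]; exact hθ.const_smul σ
  have hD2 : ∀ y u w, fderiv ℝ (fderiv ℝ f) y u w = σ * fderiv ℝ (fun x => fderiv ℝ θ x w) y u := by
    intro y u w
    rw [fderiv_fderiv_eq_coord hf]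
    have e1 : (fun x => fderiv ℝ f x w) = fun x => σ * fderiv ℝ θ x w := by
      funext x
      rw [hfθ, fderiv_const_smul ((hθ.differentiable (by norm_num)) x) σ]
      simp [smul_eq_mul]
    rw [e1]
    have hdw : DifferentiableAt ℝ (fun x => fderiv ℝ θ x w) y :=
      (((hθ.fderiv_right (m := 1) (by norm_num)).differentiable one_ne_zero).clm_apply (differentiable_const w)) y
    rw [show (fun x => σ * fderiv ℝ θ x w) = σ • (fun x => fderiv ℝ θ x w) by funext x; simp [smul_eq_mul], fderiv_const_smul hdw σ]
    simp [smul_eq_mul]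
  have hhot_iff : ∀ y : EuclideanSpace ℝ (Fin 3), f y = M ↔ U (-1) y 2 = U (-1) 0 2 := fun y => by
    simp only [hfdef, hMdef]; exact mul_right_inj' hσ0
  -- the slope at the thread plane is `≤ 0`, in particular `≠ 1`
  have hslope := hevU (-1) (by simpa using hρ)
  have hμle : μ (-1) 0 ≤ 0 :=
    slopeFunction_nonpos hUrate hUcont hUmild hUdiv hUpol hUne hUhotbd hμ3.continuous (hslope 0 rfl)
  have hμ1 : μ (-1) 0 ≠ 1 := by linarith
  -- the reference hot point `Γ 0`, where `Γ′(0)` is a kernel direction of `D²f`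
  have hΓd : ∀ t, HasDerivAt Γ (deriv Γ t) t := fun t => ((hΓc2.differentiable (by norm_num)) t).hasDerivAt
  have hT2 : deriv Γ 0 2 = 0 := deriv_apply_two_eq_zero (hΓd 0) hΓ2
  have hhotf : ∀ s, f (Γ s) = M := fun s => (hhot_iff _).2 (hΓhot s)
  have hcritf : ∀ y : EuclideanSpace ℝ (Fin 3), y 2 = 0 → f y = M → fderiv ℝ f y = 0 := by
    intro y hy2 hyM
    have h := hUcrit y ⟨hy2, (hhot_iff y).1 hyM⟩
    have e : f = fun x => σ * (fun x => U (-1) x 2) x := rfl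
    rw [e, fderiv_const_mul ((hθ.differentiable (by norm_num)) y), h, smul_zero]
  have hker : ∀ w, fderiv ℝ (fderiv ℝ f) (Γ 0) (deriv Γ 0) w = 0 := fun w =>
    hessian_apply_deriv_eq_zero_of_hot hf hcritf (hΓd 0) hΓ2 hhotf w
  have htrace0 := frame_trace (fderiv ℝ (fderiv ℝ f) (Γ 0)) hT2 (hΓunit 0)
  have hνJ : νΓ 0 = rotJ (deriv Γ 0) := by rw [hν 0]; rfl
  set κ' : ℝ := -(fderiv ℝ (fderiv ℝ f) (Γ 0) e0 e0 + fderiv ℝ (fderiv ℝ f) (Γ 0) e1 e1) with hκ'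
  have hκκ' : κ ≤ κ' := by
    have h := hΓcurv 0
    rw [hνJ] at h
    rw [hκ', ← htrace0, hker, zero_add]
    exact h
  refine ⟨κ', hκκ', fun y hy2 hyM => ?_⟩
  -- the horizontal Laplacian of `θ` is the same at `y` and at `Γ 0`
  have hL := horizLaplacian_two_eq_of_hotPoints hUrate hUcont hUmild hUdiv hUpol hμ3 hslope hμ1 hUne hUhotbd hy2 (hΓ2 0)
    ((hhot_iff y).1 hyM) (hΓhot 0)
  have e0s : (e0 : EuclideanSpace ℝ (Fin 3)) = EuclideanSpace.single 0 1 := rfl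
  have e1s : (e1 : EuclideanSpace ℝ (Fin 3)) = EuclideanSpace.single 1 1 := rfl
  rw [hκ', neg_neg, hD2, hD2, hD2, hD2, e0s, e1s]
  simp only [hθdef] at hL ⊢
  linear_combination σ * hL

/-- ★ **THE LIMIT BRANCH IS AN INJECTIVE, PROPERLY EMBEDDED LINE.**  U-package of (Q4) (hypothesis names of `…Q4WebPackage.line_web_package`, plus the Peakless
clause `hUpeak` and the re-entry clause `hUcrit` of the same package) ⇒ `Γ` is injective and `‖Γ s‖ → ∞` as `s → +∞` and as `s → −∞`. -/
theorem limitBranch_injective_proper (hUrate : HasTypeITimeDecay C U) (hUcont : ContinuousOn (uncurry U) (Iio (0 : ℝ) ×ˢ univ))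
    (hUmild : ∀ s t : ℝ, s < t → t < 0 → ∀ x, U t x = heatExtension (U s) (t - s) x - oseenDuhamel 1 s U U t x)
    (hUdiv : ∀ t < 0, VectorCalculus.IsDivFree (U t))
    (hUpol : ∀ s < 0, ∀ q, ⟪curl (U s) q, EuclideanSpace.single 2 1⟫_ℝ = 0)
    (hUne : U (-1) 0 2 ≠ 0) (hUhotbd : ∀ t < 0, ∀ x, Real.sqrt (-t) * |U t x 2| ≤ |U (-1) 0 2|)
    (hUpeak : ∀ (s z₀ σ M : ℝ) (K O : Set (EuclideanSpace ℝ (Fin 3))), s < 0 →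
      ((σ = 1 ∨ σ = -1) ∧ IsCompact K ∧ K.Nonempty ∧ (∀ q ∈ K, q 2 = z₀ ∧ σ * U s q 2 = M) ∧
        IsOpen O ∧ K ⊆ O ∧ (∀ q ∈ O, q 2 = z₀ → σ * U s q 2 ≤ M) ∧
        (∀ q ∈ O, q 2 = z₀ → σ * U s q 2 = M → q ∈ K)) → False)
    (hUcrit : ∀ y ∈ {y : EuclideanSpace ℝ (Fin 3) | y 2 = 0 ∧ U (-1) y 2 = U (-1) 0 2}, fderiv ℝ (fun x => U (-1) x 2) y = 0)
    {σ κ : ℝ} (hσ : σ = 1 ∨ σ = -1) (hσN : σ * U (-1) 0 2 = |U (-1) 0 2|) (hκ : 0 < κ)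
    {Γ νΓ : ℝ → EuclideanSpace ℝ (Fin 3)} (hΓc2 : ContDiff ℝ 2 Γ) (hΓ2 : ∀ s, Γ s 2 = 0) (hΓunit : ∀ s, ‖deriv Γ s‖ = 1)
    (hΓhot : ∀ s, U (-1) (Γ s) 2 = U (-1) 0 2)
    (hν : ∀ s, νΓ s = WithLp.toLp 2 ![-(deriv Γ s 1), deriv Γ s 0, 0])
    (hΓcurv : ∀ s, κ ≤ -(fderiv ℝ (fderiv ℝ (fun y => σ * U (-1) y 2)) (Γ s) (νΓ s) (νΓ s)))
    {μ : ℝ → ℝ → ℝ} {ρ : ℝ} (hρ : 0 < ρ) (hμ3 : ContDiff ℝ 3 (uncurry μ))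
    (hevU : ∀ t₀ : ℝ, |t₀ + 1| < ρ → ∀ y₀ : EuclideanSpace ℝ (Fin 3), y₀ 2 = 0 →
      ∀ᶠ z in 𝓝 ((t₀, y₀) : ℝ × EuclideanSpace ℝ (Fin 3)), ∀ b : Fin 3, b ≠ 2 →
        fderiv ℝ (U z.1) z.2 (EuclideanSpace.single 2 1) b = μ z.1 (z.2 2) * fderiv ℝ (U z.1) z.2 (EuclideanSpace.single b 1) 2) :
    Injective Γ ∧ Tendsto (fun s => ‖Γ s‖) atTop atTop ∧ Tendsto (fun s => ‖Γ s‖) atBot atTop := by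
  have h1 : (-1 : ℝ) < 0 := by norm_num
  have hσ0 : σ ≠ 0 := by rcases hσ with rfl | rfl <;> norm_num
  set f : EuclideanSpace ℝ (Fin 3) → ℝ := fun y => σ * U (-1) y 2 with hfdef
  set M : ℝ := σ * U (-1) 0 2 with hMdef
  -- analyticity and the KNSS slice bounds of `f`
  have hslice_an : AnalyticOnNhd ℝ (U (-1)) univ := analyticOnNhd_slice hUcont (bdd_of_hasTypeITimeDecay hUrate) hUmild h1
  have hslice : ContDiff ℝ ∞ (U (-1)) := contDiffOn_univ.1 hslice_an.contDiffOn_of_completeSpace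
  have hθan : AnalyticOnNhd ℝ (fun y => U (-1) y 2) univ := fun y hy =>
    ((EuclideanSpace.proj (𝕜 := ℝ) (2 : Fin 3)).analyticAt _).comp (hslice_an y hy)
  have hfa : AnalyticOnNhd ℝ f univ := fun x hx => analyticAt_const.mul (hθan x hx)
  have hwdiv : ∀ t < 0, IsWeaklyDivFree (U t) := fun t ht =>
    VectorCalculus.IsDivFree.isWeaklyDivFree_holds (hUdiv t ht)
      ((contDiffOn_univ.1 (analyticOnNhd_slice hUcont (bdd_of_hasTypeITimeDecay hUrate) hUmild ht).contDiffOn_of_completeSpace).of_le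
        (by exact WithTop.coe_le_coe.2 le_top))
  have hbound : ∀ k : ℕ, ∃ Ck : ℝ, ∀ x, ‖iteratedFDeriv ℝ k f x‖ ≤ Ck := fun k => by
    obtain ⟨K, hK⟩ := exists_norm_iteratedFDeriv_le_slice_of_hasTypeITimeDecay hUrate hUcont hUmild hwdiv h1 k
    exact ⟨K, fun x => (norm_iteratedFDeriv_signed_le hslice hσ k x).trans (hK x)⟩
  obtain ⟨C₂, hC₂⟩ := hbound 2
  obtain ⟨C₃, hC₃⟩ := hbound 3
  obtain ⟨C₄, hC₄⟩ := hbound 4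
  -- the hot set in terms of `f`; criticality
  have hhot_iff : ∀ y : EuclideanSpace ℝ (Fin 3), f y = M ↔ U (-1) y 2 = U (-1) 0 2 := fun y => by
    simp only [hfdef, hMdef]; exact mul_right_inj' hσ0
  have hθd : Differentiable ℝ (fun y => U (-1) y 2) := fun y => (hθan y (mem_univ y)).differentiableAt
  have hcritf : ∀ y : EuclideanSpace ℝ (Fin 3), y 2 = 0 → f y = M → fderiv ℝ f y = 0 := by
    intro y hy2 hyM
    have h := hUcrit y ⟨hy2, (hhot_iff y).1 hyM⟩
    have e : f = fun x => σ * (fun x => U (-1) x 2) x := rfl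
    rw [e, fderiv_const_mul (hθd y), h, smul_zero]
  -- the ridge law on the whole hot set, with `κ' ≥ κ > 0`
  obtain ⟨κ', hκκ', htr⟩ := ridgeLaw_of_limit hUrate hUcont hUmild hUdiv hUpol hUne hUhotbd hUcrit hσ hΓc2 hΓ2 hΓunit hΓhot hν hΓcurv
    hρ hμ3 hevU
  have hκ' : κ' ≠ 0 := by linarith
  -- no compact isolated hot piece; non-isolation of hot points
  have hiso := hiso_of_peakless hUhotbd hσ hσN hUpeak
  have hni : ∀ y : EuclideanSpace ℝ (Fin 3), y 2 = 0 → f y = M → ∀ r > 0,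
      ∃ y' : EuclideanSpace ℝ (Fin 3), y' 2 = 0 ∧ f y' = M ∧ y' ≠ y ∧ dist y' y < r := by
    intro y hy2 hyM r hr
    by_contra hcon
    push Not at hcon
    refine hiso {y} isCompact_singleton (singleton_nonempty y) (fun y' hy' => ?_) (ball y r) isOpen_ball
      (singleton_subset_iff.2 (mem_ball_self hr)) ?_
    · rw [mem_singleton_iff] at hy'; subst hy'; exact ⟨hy2, hyM⟩
    · intro y' hy'b hy'2 hy'M
      rw [mem_singleton_iff]
      by_contra hne
      exact absurd (mem_ball.1 hy'b) (not_lt.2 (hcon y' hy'2 hy'M hne))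
  have hhotf : ∀ s, f (Γ s) = M := fun s => (hhot_iff _).2 (hΓhot s)
  exact ⟨goodCurve_injective hfa hC₂ hC₃ hC₄ hκ' hcritf htr hiso hΓc2 hΓ2 hhotf hΓunit,
    tendsto_norm_goodCurve_atTop hfa hC₂ hC₃ hC₄ hκ' hcritf htr hni hiso hΓc2 hΓ2 hhotf hΓunit,
    tendsto_norm_goodCurve_atBot hfa hC₂ hC₃ hC₄ hκ' hcritf htr hni hiso hΓc2 hΓ2 hhotf hΓunit⟩

end Summit.NavierStokesRegularity.NavierStokesRegularity.Theorems.PoloidalWindowDoorLrcModEntireQ4LimitBranchProper
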